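import Mathlib
import Literature.Analysis.FunctionSpaces.SobolevTraceDensityProofs
import Literature.Analysis.FunctionSpaces.Mollification
import HarnessLib

/-!
# The DiPerna–Lions first-order commutator, II: the divergence identity against a kernel and the smooth case

Analysis/FunctionSpaces support file (everything proved), sequel of `SobolevGradCommutatorL1` (the uniform bound).
For `u ∈ W^{1,1}_loc` with whole-space weak gradient `Du` (`HasWeakFDerivOn ⊤ μ u Du`), a test function `ψ ∈ C_c^∞` and a
`C¹` kernel `k` (any finite-dimensional real inner product space, Haar measure `μ`):

* `integral_mul_inner_gradient_kernel_eq` — **the weak product rule `div(ψu) = ⟪∇ψ,u⟫ + ψ div u` tested with `k(x − ·)`**: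
  `∫ ψ(y)⟪u(y), ∇k(x−y)⟫ dy = ∫ k(x−y)(⟪∇ψ(y), u(y)⟫ + ψ(y)·tr Du(y)) dy` for every `x`
  (the defining identity of `Du` with the test function `y ↦ ψ(y)k(x−y)`, contracted over an orthonormal basis;
  `div u = tr Du = Σᵢ⟪Du eᵢ, eᵢ⟫`, `LinearMap.trace_eq_sum_inner`);
* `gradCommutator_eq_of_smooth` — hence, for SMOOTH `θ = ψ`, the first-order commutator of `SobolevGradCommutatorL1` is
  `R_k ψ(x) = ∫ ψ(y)⟪u(x) − u(y), ∇k(x−y)⟫ dy = ⟪u(x), ∫ k(x−y)∇ψ(y) dy⟫ − ∫ k(x−y)⟪∇ψ(y),u(y)⟫ dy − ∫ k(x−y)ψ(y) tr Du(y) dy`,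
  i.e. `R_kψ + k ⋆ (ψ div u) = ⟪u, k ⋆ ∇ψ⟫ − k ⋆ ⟪∇ψ, u⟫`, whose two terms have the same limit `⟪u,∇ψ⟫` as `k → δ`
  (DiPerna–Lions 1989, Lemma II.1, the smooth step of the density argument; the passage to the limit is not done here).

[cite: DiPernaLions1989, Lemma II.1 (proof)]; [cite: Evans2010, §5.2.1 (definition of the weak derivative), App. C.4]
-/

noncomputable section

open MeasureTheory Set Filter Metric Function Module
open scoped ENNReal NNReal InnerProductSpace Topology RealInnerProductSpace ContDiff

namespace Literature.Analysis.FunctionSpaces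

variable {H : Type*} [NormedAddCommGroup H] [InnerProductSpace ℝ H] [FiniteDimensional ℝ H]
  [MeasurableSpace H] [BorelSpace H]

section DivergenceIdentity

variable (μ : Measure H)
variable {u : H → H} {Du : H → H →L[ℝ] H} {ψ k : H → ℝ}

omit [FiniteDimensional ℝ H] [MeasurableSpace H] [BorelSpace H] in
/-- The test function `y ↦ ψ(y) k(x − y)` (`ψ ∈ C_c^∞`, `k ∈ C^∞`). [cite: Evans2010, App. C.4 (mollifier as a test function)] -/
theorem isTestFunctionOn_mul_comp_sub (hψ : IsTestFunctionOn (⊤ : TopologicalSpace.Opens H) ψ) (hk : ContDiff ℝ ∞ k) (x : H) :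
    IsTestFunctionOn (⊤ : TopologicalSpace.Opens H) (fun y => ψ y * k (x - y)) where
  contDiff := hψ.contDiff.mul (hk.comp (contDiff_const.sub contDiff_id))
  hasCompactSupport := hψ.hasCompactSupport.mul_right
  tsupport_subset := by simp

omit [FiniteDimensional ℝ H] [MeasurableSpace H] [BorelSpace H] in
/-- Derivative of `y ↦ ψ(y) k(x − y)`: `Dψ(y)v · k(x−y) − ψ(y) · Dk(x−y)v`. [cite: Evans2010, App. C.4] -/
theorem fderiv_mul_comp_sub_apply (hψ : ContDiff ℝ 1 ψ) (hk : ContDiff ℝ 1 k) (x y v : H) :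
    fderiv ℝ (fun y => ψ y * k (x - y)) y v = fderiv ℝ ψ y v * k (x - y) - ψ y * fderiv ℝ k (x - y) v := by
  have hψd : DifferentiableAt ℝ ψ y := (hψ.differentiable one_ne_zero).differentiableAt
  have hkd : DifferentiableAt ℝ (fun z => k (x - z)) y :=
    ((hk.differentiable one_ne_zero) _).comp y ((differentiableAt_id).const_sub x)
  rw [fderiv_fun_mul hψd hkd]
  simp only [add_apply, smul_apply, smul_eq_mul, fderiv_comp_sub_left_apply hk x y v]
  ring

/-- `⟪g, u⟫ ∈ L¹` for `g` continuous with compact support and `u ∈ L¹_loc`. [cite: Evans2010, §5.2.1 (pairings of test functions with locally integrable functions)] -/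
theorem integrable_inner_of_hasCompactSupport {g v : H → H} (hg : Continuous g) (hgs : HasCompactSupport g)
    (hv : LocallyIntegrable v μ) : Integrable (fun y => ⟪g y, v y⟫) μ := by
  have h1 : Integrable (fun y => ‖g y‖ • v y) μ := hv.integrable_smul_left_of_hasCompactSupport hg.norm hgs.norm
  refine h1.norm.mono' (hg.aestronglyMeasurable.inner hv.aestronglyMeasurable) (Eventually.of_forall fun y => ?_)
  rw [norm_smul, norm_norm]
  exact norm_inner_le_norm _ _

/-- **The weak product rule `div(ψu) = ⟪∇ψ, u⟫ + ψ·div u` tested with a kernel `k(x − ·)`**: for `u` with whole-space weak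
gradient `Du`, `ψ ∈ C_c^∞`, `k ∈ C^∞` and every `x`,
`∫ ψ(y)⟪u(y), ∇k(x−y)⟫ dy = ∫ k(x−y)·(⟪∇ψ(y), u(y)⟫ + ψ(y)·tr Du(y)) dy`.
[cite: Evans2010, §5.2.1 (definition of the weak derivative; product with a smooth function)] -/
theorem integral_mul_inner_gradient_kernel_eq
    (hDu : HasWeakFDerivOn (⊤ : TopologicalSpace.Opens H) μ u Du)
    (hψ : IsTestFunctionOn (⊤ : TopologicalSpace.Opens H) ψ) (hk : ContDiff ℝ ∞ k) (x : H) :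
    ∫ y, ψ y * ⟪u y, gradient k (x - y)⟫ ∂μ =
      ∫ y, k (x - y) * (⟪gradient ψ y, u y⟫ + ψ y * LinearMap.trace ℝ H (Du y : H →ₗ[ℝ] H)) ∂μ := by
  set b := stdOrthonormalBasis ℝ H with hb
  set φx : H → ℝ := fun y => ψ y * k (x - y) with hφx
  have hφxt : IsTestFunctionOn (⊤ : TopologicalSpace.Opens H) φx := isTestFunctionOn_mul_comp_sub hψ hk x
  have hul : LocallyIntegrableOn u ((⊤ : TopologicalSpace.Opens H) : Set H) μ := hDu.locallyIntegrableOn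
  have hul' : LocallyIntegrable u μ := by
    have h := hul
    rwa [TopologicalSpace.Opens.coe_top, locallyIntegrableOn_univ] at h
  have hk1 : ContDiff ℝ 1 k := hk.of_le (by exact_mod_cast le_top)
  have hψ1 : ContDiff ℝ 1 ψ := hψ.contDiff.of_le (by exact_mod_cast le_top)
  have hgψc : Continuous (gradient ψ) := by
    have e : gradient ψ = fun y => (InnerProductSpace.toDual ℝ H).symm (fderiv ℝ ψ y) := rfl
    rw [e]; exact (InnerProductSpace.toDual ℝ H).symm.continuous.comp (hψ.contDiff.continuous_fderiv (by simp))
  have hgkc : Continuous (gradient k) := by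
    have e : gradient k = fun y => (InnerProductSpace.toDual ℝ H).symm (fderiv ℝ k y) := rfl
    rw [e]; exact (InnerProductSpace.toDual ℝ H).symm.continuous.comp (hk.continuous_fderiv (by simp))
  -- the `i`-th component of the weak-derivative identity with the test function `φx`
  have hcomp : ∀ i, ∫ y, fderiv ℝ φx y (b i) * ⟪u y, b i⟫ ∂μ = -∫ y, φx y * ⟪Du y (b i), b i⟫ ∂μ := by
    intro i
    have key := hDu.integral_fderiv_smul_eq φx (b i) hφxt
    simp only [TopologicalSpace.Opens.coe_top, Measure.restrict_univ] at key
    have hI1 : Integrable (fun y => (fderiv ℝ φx y (b i)) • u y) μ := by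
      have h := SobolevApprox.integrableOn_fderiv_testFunction_smul hφxt (b i) hul
      rwa [TopologicalSpace.Opens.coe_top, integrableOn_univ] at h
    have hI2 : Integrable (fun y => φx y • Du y (b i)) μ := by
      have h := SobolevApprox.integrableOn_testFunction_smul hφxt (SobolevApprox.locallyIntegrableOn_deriv_apply hDu (b i))
      rwa [TopologicalSpace.Opens.coe_top, integrableOn_univ] at h
    have h1 : ∫ y, fderiv ℝ φx y (b i) * ⟪u y, b i⟫ ∂μ = ⟪b i, ∫ y, (fderiv ℝ φx y (b i)) • u y ∂μ⟫ := by
      rw [← integral_inner hI1]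
      refine integral_congr_ae (Eventually.of_forall fun y => ?_)
      simp only [real_inner_smul_right, real_inner_comm]
    have h2 : ∫ y, φx y * ⟪Du y (b i), b i⟫ ∂μ = ⟪b i, ∫ y, φx y • Du y (b i) ∂μ⟫ := by
      rw [← integral_inner hI2]
      refine integral_congr_ae (Eventually.of_forall fun y => ?_)
      simp only [real_inner_smul_right, real_inner_comm]
    rw [h1, h2, key, inner_neg_right]
  -- sum over the orthonormal basis
  have hIa : ∀ i, Integrable (fun y => fderiv ℝ φx y (b i) * ⟪u y, b i⟫) μ := fun i => by
    have h := SobolevApprox.integrableOn_fderiv_testFunction_smul hφxt (b i) hul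
    rw [TopologicalSpace.Opens.coe_top, integrableOn_univ] at h
    refine (h.inner_const (b i)).congr (Eventually.of_forall fun y => ?_)
    simp only [real_inner_smul_left]
  have hIc : ∀ i, Integrable (fun y => φx y * ⟪Du y (b i), b i⟫) μ := fun i => by
    have h := SobolevApprox.integrableOn_testFunction_smul hφxt (SobolevApprox.locallyIntegrableOn_deriv_apply hDu (b i))
    rw [TopologicalSpace.Opens.coe_top, integrableOn_univ] at h
    refine (h.inner_const (b i)).congr (Eventually.of_forall fun y => ?_)
    simp only [real_inner_smul_left]
  have hsum : ∫ y, ∑ i, fderiv ℝ φx y (b i) * ⟪u y, b i⟫ ∂μ = -∫ y, ∑ i, φx y * ⟪Du y (b i), b i⟫ ∂μ := by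
    rw [integral_finsetSum _ fun i _ => hIa i, integral_finsetSum _ fun i _ => hIc i, ← Finset.sum_neg_distrib]
    exact Finset.sum_congr rfl fun i _ => hcomp i
  -- pointwise identification of the sums
  have hL : ∀ y, ∑ i, fderiv ℝ φx y (b i) * ⟪u y, b i⟫ =
      k (x - y) * ⟪gradient ψ y, u y⟫ - ψ y * ⟪gradient k (x - y), u y⟫ := by
    intro y
    have g1 : ∀ v, ⟪gradient ψ y, v⟫ = fderiv ℝ ψ y v := fun v => by
      simp only [gradient, InnerProductSpace.toDual_symm_apply]
    have g2 : ∀ v, ⟪gradient k (x - y), v⟫ = fderiv ℝ k (x - y) v := fun v => by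
      simp only [gradient, InnerProductSpace.toDual_symm_apply]
    have e : ∀ i, fderiv ℝ φx y (b i) * ⟪u y, b i⟫ =
        k (x - y) * (⟪gradient ψ y, b i⟫ * ⟪b i, u y⟫) - ψ y * (⟪gradient k (x - y), b i⟫ * ⟪b i, u y⟫) := by
      intro i
      rw [hφx, fderiv_mul_comp_sub_apply hψ1 hk1 x y (b i), g1, g2, ← real_inner_comm (b i) (u y)]
      ring
    simp only [e, Finset.sum_sub_distrib, ← Finset.mul_sum, b.sum_inner_mul_inner]
  have hR : ∀ y, ∑ i, φx y * ⟪Du y (b i), b i⟫ = φx y * LinearMap.trace ℝ H (Du y : H →ₗ[ℝ] H) := by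
    intro y
    rw [← Finset.mul_sum, LinearMap.trace_eq_sum_inner _ b]
    congr 1
    exact Finset.sum_congr rfl fun i _ => by rw [real_inner_comm]; rfl
  -- integrability of the three pieces
  have hJ1 : Integrable (fun y => k (x - y) * ⟪gradient ψ y, u y⟫) μ := by
    have hgs : HasCompactSupport (gradient ψ) := by
      have e : gradient ψ = (InnerProductSpace.toDual ℝ H).symm ∘ fderiv ℝ ψ := rfl
      rw [e]; exact (hψ.hasCompactSupport.fderiv (𝕜 := ℝ)).comp_left (map_zero _)
    have h := integrable_inner_of_hasCompactSupport μ (g := fun y => k (x - y) • gradient ψ y)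
      ((hk.continuous.comp (continuous_const.sub continuous_id)).smul hgψc) (hgs.smul_left) hul'
    refine h.congr (Eventually.of_forall fun y => ?_)
    beta_reduce
    rw [real_inner_smul_left]
  have hJ2 : Integrable (fun y => ψ y * ⟪gradient k (x - y), u y⟫) μ := by
    have h := integrable_inner_of_hasCompactSupport μ (g := fun y => ψ y • gradient k (x - y))
      (hψ.contDiff.continuous.smul (hgkc.comp (continuous_const.sub continuous_id))) (hψ.hasCompactSupport.smul_right) hul'
    refine h.congr (Eventually.of_forall fun y => ?_)
    beta_reduce
    rw [real_inner_smul_left]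
  have hJ3 : Integrable (fun y => φx y * LinearMap.trace ℝ H (Du y : H →ₗ[ℝ] H)) μ :=
    (integrable_finsetSum Finset.univ fun i _ => hIc i).congr (Eventually.of_forall fun y => by
      beta_reduce; exact hR y)
  simp_rw [hL, hR] at hsum
  rw [integral_sub hJ1 hJ2] at hsum
  have eI : ∫ y, ψ y * ⟪u y, gradient k (x - y)⟫ ∂μ = ∫ y, ψ y * ⟪gradient k (x - y), u y⟫ ∂μ :=
    integral_congr_ae (Eventually.of_forall fun y => by beta_reduce; rw [real_inner_comm])
  rw [eI]
  have e3 : ∫ y, k (x - y) * (⟪gradient ψ y, u y⟫ + ψ y * LinearMap.trace ℝ H (Du y : H →ₗ[ℝ] H)) ∂μ =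
      (∫ y, k (x - y) * ⟪gradient ψ y, u y⟫ ∂μ) + ∫ y, φx y * LinearMap.trace ℝ H (Du y : H →ₗ[ℝ] H) ∂μ := by
    rw [← integral_add hJ1 hJ3]
    refine integral_congr_ae (Eventually.of_forall fun y => ?_)
    simp only [hφx]
    ring
  rw [e3]
  linarith

/-- **The first-order commutator for SMOOTH `θ = ψ`** (the smooth step of DiPerna–Lions 1989, Lemma II.1):
`∫ ψ(y)⟪u(x) − u(y), ∇k(x−y)⟫ dy = ⟪u(x), ∫ ψ(y)∇k(x−y) dy⟫ − ∫ k(x−y)⟪∇ψ(y), u(y)⟫ dy − ∫ k(x−y)ψ(y)·tr Du(y) dy`.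
[cite: DiPernaLions1989, Lemma II.1 (proof, smooth case)] -/
theorem gradCommutator_eq_of_smooth [IsFiniteMeasureOnCompacts μ]
    (hDu : HasWeakFDerivOn (⊤ : TopologicalSpace.Opens H) μ u Du)
    (hψ : IsTestFunctionOn (⊤ : TopologicalSpace.Opens H) ψ) (hk : ContDiff ℝ ∞ k) (x : H) :
    ∫ y, ψ y * ⟪u x - u y, gradient k (x - y)⟫ ∂μ =
      ⟪u x, ∫ y, ψ y • gradient k (x - y) ∂μ⟫ - ∫ y, k (x - y) * ⟪gradient ψ y, u y⟫ ∂μ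
        - ∫ y, k (x - y) * ψ y * LinearMap.trace ℝ H (Du y : H →ₗ[ℝ] H) ∂μ := by
  have hgkc : Continuous (gradient k) := by
    have e : gradient k = fun y => (InnerProductSpace.toDual ℝ H).symm (fderiv ℝ k y) := rfl
    rw [e]; exact (InnerProductSpace.toDual ℝ H).symm.continuous.comp (hk.continuous_fderiv (by simp))
  have hul' : LocallyIntegrable u μ := by
    have h := hDu.locallyIntegrableOn
    rwa [TopologicalSpace.Opens.coe_top, locallyIntegrableOn_univ] at h
  -- `ψ(y) • ∇k(x − y)` is continuous with compact support
  have hgc : Continuous fun y => ψ y • gradient k (x - y) :=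
    hψ.contDiff.continuous.smul (hgkc.comp (continuous_const.sub continuous_id))
  have hgs : HasCompactSupport fun y => ψ y • gradient k (x - y) := hψ.hasCompactSupport.smul_right
  have hI1 : Integrable (fun y => ψ y • gradient k (x - y)) μ := hgc.integrable_of_hasCompactSupport hgs
  have hI2 : Integrable (fun y => ψ y * ⟪u y, gradient k (x - y)⟫) μ := by
    have h := integrable_inner_of_hasCompactSupport μ hgc hgs hul'
    refine h.congr (Eventually.of_forall fun y => ?_)
    beta_reduce
    rw [real_inner_smul_left, real_inner_comm]
  have hsplit : ∀ y, ψ y * ⟪u x - u y, gradient k (x - y)⟫ =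
      ⟪u x, ψ y • gradient k (x - y)⟫ - ψ y * ⟪u y, gradient k (x - y)⟫ := fun y => by
    rw [inner_sub_left, real_inner_smul_right]
    ring
  simp_rw [hsplit]
  rw [integral_sub (hI1.const_inner (𝕜 := ℝ) (u x)) hI2, integral_inner hI1,
    integral_mul_inner_gradient_kernel_eq μ hDu hψ hk x]
  -- regroup the last integral
  have hgψc : Continuous (gradient ψ) := by
    have e : gradient ψ = fun y => (InnerProductSpace.toDual ℝ H).symm (fderiv ℝ ψ y) := rfl
    rw [e]; exact (InnerProductSpace.toDual ℝ H).symm.continuous.comp (hψ.contDiff.continuous_fderiv (by simp))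
  have hgψs : HasCompactSupport (gradient ψ) := by
    have e : gradient ψ = (InnerProductSpace.toDual ℝ H).symm ∘ fderiv ℝ ψ := rfl
    rw [e]; exact (hψ.hasCompactSupport.fderiv (𝕜 := ℝ)).comp_left (map_zero _)
  have hJ1 : Integrable (fun y => k (x - y) * ⟪gradient ψ y, u y⟫) μ := by
    have h := integrable_inner_of_hasCompactSupport μ (g := fun y => k (x - y) • gradient ψ y)
      ((hk.continuous.comp (continuous_const.sub continuous_id)).smul hgψc) (hgψs.smul_left) hul'
    refine h.congr (Eventually.of_forall fun y => ?_)
    beta_reduce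
    rw [real_inner_smul_left]
  -- the trace part is integrable: `(ψ k(x−·)) • tr Du`, `tr ∘ Du ∈ L¹_loc`
  have hφxt : IsTestFunctionOn (⊤ : TopologicalSpace.Opens H) (fun y => ψ y * k (x - y)) :=
    isTestFunctionOn_mul_comp_sub hψ hk x
  set T : (H →L[ℝ] H) →L[ℝ] ℝ :=
    LinearMap.toContinuousLinearMap ((LinearMap.trace ℝ H) ∘ₗ (ContinuousLinearMap.coeLM ℝ)) with hT
  have hTapp : ∀ A : H →L[ℝ] H, T A = LinearMap.trace ℝ H (A : H →ₗ[ℝ] H) := fun A => rfl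
  have htr : LocallyIntegrableOn (fun y => T (Du y)) ((⊤ : TopologicalSpace.Opens H) : Set H) μ :=
    T.locallyIntegrableOn_comp hDu.locallyIntegrableOn_deriv
  have hJ3 : Integrable (fun y => k (x - y) * ψ y * LinearMap.trace ℝ H (Du y : H →ₗ[ℝ] H)) μ := by
    have h := SobolevApprox.integrableOn_testFunction_smul hφxt htr
    rw [TopologicalSpace.Opens.coe_top, integrableOn_univ] at h
    refine h.congr (Eventually.of_forall fun y => ?_)
    beta_reduce
    rw [smul_eq_mul, hTapp]
    ring
  have e3 : ∫ y, k (x - y) * (⟪gradient ψ y, u y⟫ + ψ y * LinearMap.trace ℝ H (Du y : H →ₗ[ℝ] H)) ∂μ =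
      (∫ y, k (x - y) * ⟪gradient ψ y, u y⟫ ∂μ) + ∫ y, k (x - y) * ψ y * LinearMap.trace ℝ H (Du y : H →ₗ[ℝ] H) ∂μ := by
    rw [← integral_add hJ1 hJ3]
    refine integral_congr_ae (Eventually.of_forall fun y => ?_)
    beta_reduce
    ring
  rw [e3]
  ring

end DivergenceIdentity

end Literature.Analysis.FunctionSpaces

end
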